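import Summits.Ventures.PackingBounds.Energy.FivePointQuartic
import Summits.Ventures.PackingBounds.Configurations.FivePointConfigs
import HarnessLib

/-!
# Five points on `S²`, potential `(1+⟪x,y⟫)⁴`: the two-sided statement

Framing: lottery ticket; floor = certified bounds/negative ranges. Venture `PackingBounds`, cell
`pub-packcert`, energy family E3PT (pub-packcert-energy gen 12).

Combines the kernel-checked sharp three-point bound `FivePointQuartic.ck4_five_points`
(`Σ_{x ≠ y} (1+⟪x,y⟫)⁴ ≥ 99/8` for every five unit vectors of `ℝ³`) with the explicit triangular bipyramid
`Config.Bipyramid.pts` (inner products `-1, -1/2, 0`): the minimum is exactly `99/8` (ordered pairs),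
attained by the triangular bipyramid.
-/

noncomputable section

open Finset
open scoped RealInnerProductSpace

namespace Summit.Ventures.PackingBounds.Energy.FivePointQuartic

open Summit.Ventures.PackingBounds.Config

/-- The triangular bipyramid has `(1+t)⁴`-energy `99/8` (ordered pairs: `2·(0 + 3·1) + 3·(2·1 + 2·(1/16))`). -/
theorem bipyramid_ck4_energy :
    ∑ x ∈ Bipyramid.pts, ∑ y ∈ Bipyramid.pts.erase x, (1 + inner ℝ x y) ^ 4 = 99 / 8 := by
  have e := Bipyramid.energy_pts (fun t : ℝ => (1 + t) ^ 4)
  rw [e]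
  norm_num

/-- **Five points on `S²`, potential `(1+⟪x,y⟫)⁴`, two-sided:** the least value of `Σ_{x ≠ y} (1+⟪x,y⟫)⁴`
over five unit vectors of `ℝ³` is `99/8`, attained by the triangular bipyramid. -/
theorem ck4_five_points_isLeast :
    IsLeast {E : ℝ | ∃ C : Finset (EuclideanSpace ℝ (Fin 3)), C.card = 5 ∧ (∀ x ∈ C, ‖x‖ = 1) ∧
      E = ∑ x ∈ C, ∑ y ∈ C.erase x, (1 + inner ℝ x y) ^ 4} (99 / 8) := by
  refine ⟨⟨Bipyramid.pts, Bipyramid.card_pts, Bipyramid.norm_pts, bipyramid_ck4_energy.symm⟩, ?_⟩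
  rintro E ⟨C, h5, hC, rfl⟩
  simpa using ck4_five_points C hC h5

end Summit.Ventures.PackingBounds.Energy.FivePointQuartic
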